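import Summits.ABC.IUTFork.Repair.RHHullCapacityNecessaryLinConverse
import HarnessLib

/-!
# IUT REPAIR branch → R-H (D-0079 «LOCAL-HEIGHT CONDITION I06⋆», rung LADDER-ABC:A2.RESCUE.H), row 3 «hull-capacity-necessary» —
# `RHHullCapacityNecessarySlice`: Σ₃ ∩ (one place) IS AN INITIAL SEGMENT OF LABELS `{1, …, j₀(w)}`, and the bracket `j_c ≤ j₀ ≤ j_c + 1`
# with the explicit closed index `j_c = 1 + ⌊(e_w(B_w+2) + A_w − 2)/m_q⌋` ([ED]/[INT]) resp. `1 + ⌊(e_w(B_w+1) + A_w − 2)/m_q⌋` ([LIN])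

PROOF-ONLY sequel (no `def`, no new `Prop`, no instance, no notation; nothing re-typed) of `RHHullCapacityNecessaryInt` (p463493),
`RHHullCapacityNecessaryIntConverse` (p468142) and `RHHullCapacityNecessaryLinConverse` (p470302) by the row-3 typer of record (abc-iut-rh-typ-3 gen 4)
for R-H ROUND 2 `plan/rescue/R-H/SLICE.md` (pen abc-iut-rh-lead g2; human ask relayed 21-frontier 2026-08-26 22:09Z (A): «the slice boundary j₀(w) as a
function of the local data per kept row»). Row 3's two clauses FACTOR THROUGH `(j+1)`, so after cancellation they are LINEAR in the label `j`:
[ED]/[INT] `IntCell p e m j ⟺ (j+1)·D_j + ((m − j − 1) mod e) < e`, `D_j = (j−1)·m + 2 − e·(B+2) − A` (`intCell_iff_layer`), and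
[LIN] `(j²−1)·m ≤ (j+1)·S + e`, `S = e·(B+1) + A − 2` (`cellLinAt_pilotDataOfK_iff_intLin`), `A = aWin p e`, `B = bWin p e`.

CONTENTS. §1 **`intCell_anti`**: `IntCell p e m j₂ → j₁ ≤ j₂ → IntCell p e m j₁` (`e ≥ 1`; the deficit `D_j` is nondecreasing in `j` and the residue
drops by at most one per label), **`intCell_iff_le_of_boundary`** (a label `J` inside and `J+1` outside ⟹ `IntCell j ⟺ j ≤ J`: the slice boundary
`j₀(w)` exists and there are NO sporadic labels), **`closedSuff_iff_le`** (`m ≥ 1`: `ClosedSuff p e m j ⟺ j ≤ 1 + (e(B+2)+A−2)/m` — the closed index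
`j_c`), **`closedSuff_of_intCell_succ`** (`IntCell (j+1) ⟹ ClosedSuff j`: with `intCell_of_closedSuff` this is the BRACKET `j_c ≤ j₀ ≤ j_c + 1`, the
one-residue layer adds at most ONE label). §2 the same for [LIN]: **`intLin_anti`**, **`intLin_iff_le_of_boundary`**, **`intLin_of_sub_one_mul_le`**
(`(j−1)·m ≤ S ⟹` [LIN] at `j`), **`sub_one_mul_le_of_intLin_succ`** ([LIN] at `j+1 ⟹ (j−1)·m ≤ S`: bracket `j_c^LIN ≤ j₀^LIN ≤ j_c^LIN + 1`).
§3 AT THE GENUINE DATUM `pilotDataOfK D K` (`p` odd, `p ∤ e(w|p) = e`, `P_q(w) = m`): **`cellAt_pilotDataOfK_anti`** and **`cellLinAt_pilotDataOfK_anti`** —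
H⋆₃'s [ED] cell and its [LIN] cell hold on an INITIAL SEGMENT of the labels at every such place (SLICE.md row 3 (b)). §4 one kernel evaluation where
the layer label is real INSIDE the label range (I06STAR-COLUMNS v1 G-HEX-k12-l71-ev3: `e = 213`, `m = 36`, `l⋆ = 35`, `j_c = 25`, `IntCell` holds at
`26` and fails at `27`). Seat-side numerics (exact integers, `HOME/staging/RH/abc-iut-rh-typ-3/SLICE-row3*.tsv`): 0 violations of the initial-segment
property and `j₀ − j_c ∈ {0, 1}` on all 536 packets of I06STAR-COLUMNS v1 and 63 973 genuine (place, l) pairs of rh2-q3-num's Q3-PLACES bed; first-order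
slice fraction `j₀/l⋆ ≈ min(1, 4(B_w+2)/H_w)` ([ED]) / `min(1, 4(B_w+1+(A_w−2)/e_w)/H_w)` ([LIN]), `H_w = ord_v(q_v)/e_v`.

HONEST SCOPE. Integer bookkeeping of abc-iut-w4-d092's explicit-depth container at realising ideles (R-W `margin_ED`) and of its [LIN] companion;
«cell holds» says only that THIS refuting engine is silent (row 3 is the NECESSARY side / outer locator: every admissible Σ lies inside Σ₃), never
that the licence holds; nothing here bears on the printed GLOBAL inequality. [cite: Mochizuki2012, IUTchIV Prop. 1.2 (i)(ii) p. 10; IUTchI Ex. 3.2 (iv) p. 71]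
[cite: ScholzeStix2018, §2.2 pp. 9–10] [claim: Mochizuki2012, status: disputed] for every IUT sentence; TAKES NO SIDE on [IUTchIII] Cor. 3.12 or on any
author; typed ≠ proved; instantiated ≠ endorsed; refuted-as-typed ≠ refuted-in-print; nothing here asserts abc.
-/

noncomputable section

open Set Function NumberField IsDedekindDomain
open scoped Pointwise

namespace Summit.ABC.IUTFork.Repair.RHHullCapacityNecessarySlice

open Literature.AnabelianGeometry.AbsoluteAnabelian Literature.IUT.LogThetaLattice Literature.IUT.LogVolume
  Literature.IUT.HodgeTheaters Literature.NumberTheory.NumberFields Literature.NumberTheory.GaloisRepresentations.Ultrametric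
open Summit.ABC.IUTFork.Thm311 Summit.ABC.IUTFork.Thm311.Real Summit.ABC.IUTFork.Cor312 Summit.ABC.IUTFork.Cor312.Setting
  Summit.ABC.IUTFork.Cor312Vol Summit.ABC.IUTFork.Cor312Vol.ExplicitDepth Summit.ABC.IUTFork.Cor312Prov
  Summit.ABC.IUTFork.Repair.RHHullCapacityNecessaryTyped Summit.ABC.IUTFork.Repair.RHHullCapacityNecessaryLin
  Summit.ABC.IUTFork.Repair.RHHullCapacityNecessaryInt Summit.ABC.IUTFork.Repair.RHHullCapacityNecessaryIntConverse
  Summit.ABC.IUTFork.Repair.RHHullCapacityNecessaryLinConverse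

/-! ## §1. The [ED]/[INT] cell is an initial segment of labels; closed index and bracket -/

section IntegerSlice

/-- **THE [ED] CELL IS ANTITONE IN THE LABEL** (`e ≥ 1`): `IntCell p e m j₂ → j₁ ≤ j₂ → IntCell p e m j₁`. In the exact form
`(j+1)·D_j + r_j < e` (`intCell_iff_layer`), `D_j` is nondecreasing in `j` (`m ≥ 0`) and `r_{j₁} ≤ r_{j₂} + (j₂ − j₁)` (the residue of `m − (j+1)` drops
by at most one per label), while `(j₂+1)·D_{j₂} ≥ (j₁+1)·D_{j₁} + (j₂ − j₁)` as soon as `D_{j₁} ≥ 1`; if `D_{j₁} ≤ 0` the cell holds outright. [folklore] -/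
theorem intCell_anti {p e m j₁ j₂ : ℕ} (he : 1 ≤ e) (hj : j₁ ≤ j₂) (h : IntCell p e m j₂) : IntCell p e m j₁ := by
  rw [intCell_iff_layer he] at h ⊢
  set A : ℤ := (aWin p e : ℤ) with hA
  set B : ℤ := (bWin p e : ℤ) with hB
  set D₁ : ℤ := ((j₁ : ℤ) - 1) * (m : ℤ) + 2 - (e : ℤ) * (B + 2) - A with hD₁
  set D₂ : ℤ := ((j₂ : ℤ) - 1) * (m : ℤ) + 2 - (e : ℤ) * (B + 2) - A with hD₂
  have he0 : (0 : ℤ) < (e : ℤ) := by exact_mod_cast he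
  have hr₁lt : ((m : ℤ) - ((j₁ : ℤ) + 1)) % (e : ℤ) < (e : ℤ) := Int.emod_lt_of_pos _ he0
  have hr₂0 : 0 ≤ ((m : ℤ) - ((j₂ : ℤ) + 1)) % (e : ℤ) := Int.emod_nonneg _ (ne_of_gt he0)
  have hj' : (j₁ : ℤ) ≤ (j₂ : ℤ) := by exact_mod_cast hj
  have hj0 : (0 : ℤ) ≤ (j₁ : ℤ) := by positivity
  have hm0 : (0 : ℤ) ≤ (m : ℤ) := by positivity
  rcases le_or_gt D₁ 0 with hle | hpos
  · -- the closed form holds at `j₁`: `(j₁+1)·D₁ ≤ 0 ≤ e − 1 − r₁`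
    have h1 : ((j₁ : ℤ) + 1) * D₁ ≤ 0 := by nlinarith
    linarith
  · -- `D₁ ≥ 1`: compare with `j₂`
    have hD : D₂ = D₁ + ((j₂ : ℤ) - (j₁ : ℤ)) * (m : ℤ) := by rw [hD₁, hD₂]; ring
    have hD12 : D₁ ≤ D₂ := by rw [hD]; nlinarith
    have h2 : ((j₁ : ℤ) + 1) * D₁ + ((j₂ : ℤ) - (j₁ : ℤ)) ≤ ((j₂ : ℤ) + 1) * D₂ := by
      have h21 : ((j₂ : ℤ) - (j₁ : ℤ)) * 1 ≤ ((j₂ : ℤ) - (j₁ : ℤ)) * D₁ :=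
        mul_le_mul_of_nonneg_left (by linarith) (by linarith)
      have h22 : ((j₂ : ℤ) + 1) * D₁ ≤ ((j₂ : ℤ) + 1) * D₂ := mul_le_mul_of_nonneg_left hD12 (by linarith)
      nlinarith
    -- residues: `r₁ = (r₂ + (j₂ − j₁)) mod e ≤ r₂ + (j₂ − j₁)`
    have hr : ((m : ℤ) - ((j₁ : ℤ) + 1)) % (e : ℤ) ≤ ((m : ℤ) - ((j₂ : ℤ) + 1)) % (e : ℤ) + ((j₂ : ℤ) - (j₁ : ℤ)) := by
      have hsplit : (m : ℤ) - ((j₁ : ℤ) + 1) = ((m : ℤ) - ((j₂ : ℤ) + 1)) + ((j₂ : ℤ) - (j₁ : ℤ)) := by ring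
      set x : ℤ := ((m : ℤ) - ((j₂ : ℤ) + 1)) % (e : ℤ) + ((j₂ : ℤ) - (j₁ : ℤ)) with hx
      have hx0 : 0 ≤ x := by rw [hx]; linarith
      have hmod : ((m : ℤ) - ((j₁ : ℤ) + 1)) % (e : ℤ) = x % (e : ℤ) := by
        rw [hsplit, hx, Int.emod_add_emod]
      rw [hmod, Int.emod_def]
      have hq : 0 ≤ x / (e : ℤ) := Int.ediv_nonneg hx0 he0.le
      nlinarith
    linarith

/-- **THE SLICE BOUNDARY EXISTS, NO SPORADIC LABELS**: if the label `J` is inside the [ED] cell and `J+1` is outside, then for EVERY label `j`,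
`IntCell p e m j ⟺ j ≤ J` (`J = j₀(w)` of SLICE.md row 3). [folklore] -/
theorem intCell_iff_le_of_boundary {p e m J : ℕ} (he : 1 ≤ e) (hJ : IntCell p e m J) (hJ' : ¬ IntCell p e m (J + 1)) (j : ℕ) :
    IntCell p e m j ↔ j ≤ J := by
  constructor
  · intro h
    by_contra hcon
    exact hJ' (intCell_anti he (by omega) h)
  · intro h
    exact intCell_anti he h hJ

/-- **THE CLOSED INDEX `j_c`** (`e ≥ 1`, `m ≥ 1`): `ClosedSuff p e m j ⟺ j ≤ 1 + (e·(B+2) + A − 2)/m` (division in `ℕ`), i.e.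
`j_c(w) = 1 + ⌊(e_w(B_w+2) + A_w − 2)/m_q⌋` is the largest label of the floor-free closed form. [folklore] -/
theorem closedSuff_iff_le {p e m j : ℕ} (he : 1 ≤ e) (hm : 1 ≤ m) :
    ClosedSuff p e m j ↔ j ≤ 1 + (e * (bWin p e + 2) + aWin p e - 2) / m := by
  unfold ClosedSuff
  have h2 : 2 ≤ e * (bWin p e + 2) + aWin p e := by nlinarith
  generalize e * (bWin p e + 2) + aWin p e = X at h2 ⊢
  constructor
  · intro h
    have h1 : (j - 1) * m ≤ X - 2 := by omega
    have h3 : j - 1 ≤ (X - 2) / m := (Nat.le_div_iff_mul_le hm).2 h1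
    calc j ≤ (j - 1) + 1 := by omega
      _ ≤ (X - 2) / m + 1 := Nat.add_le_add_right h3 1
      _ = 1 + (X - 2) / m := Nat.add_comm _ _
  · intro h
    have h' : j ≤ (X - 2) / m + 1 := by rwa [Nat.add_comm] at h
    have h3 : j - 1 ≤ (X - 2) / m := Nat.sub_le_iff_le_add.2 h'
    have h1 : (j - 1) * m ≤ X - 2 := (Nat.le_div_iff_mul_le hm).1 h3
    omega

/-- **THE BRACKET `j₀ ≤ j_c + 1`**: `IntCell p e m (j+1) ⟹ ClosedSuff p e m j` (`e ≥ 1`, `j ≥ 1`). With `intCell_of_closedSuff` (`ClosedSuff j ⟹ IntCell j`)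
the slice boundary satisfies `j_c ≤ j₀ ≤ j_c + 1`: the one-residue boundary layer adds AT MOST ONE label. (If `D_{j+1} ≥ m + 1` then
`(j+2)(m+1) ≤ (j+2)·D_{j+1} < e`, while `D_{j+1} ≥ m+1` forces `(j−1)m + 1 ≥ e(B+2) + A ≥ 2e` — impossible.) [folklore] -/
theorem closedSuff_of_intCell_succ {p e m j : ℕ} (he : 1 ≤ e) (hj : 1 ≤ j) (h : IntCell p e m (j + 1)) : ClosedSuff p e m j := by
  rw [intCell_iff_layer he] at h
  have he0 : (0 : ℤ) < (e : ℤ) := by exact_mod_cast he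
  have hr0 : 0 ≤ ((m : ℤ) - ((((j + 1 : ℕ)) : ℤ) + 1)) % (e : ℤ) := Int.emod_nonneg _ (ne_of_gt he0)
  have hlay : ((((j + 1 : ℕ)) : ℤ) + 1) * ((((((j + 1 : ℕ)) : ℤ)) - 1) * (m : ℤ) + 2 - (e : ℤ) * ((bWin p e : ℤ) + 2) - (aWin p e : ℤ)) <
      (e : ℤ) := by linarith
  push_cast at hlay
  unfold ClosedSuff
  by_contra hcon
  have hcon' : e * (bWin p e + 2) + aWin p e < (j - 1) * m + 2 := not_le.1 hcon
  have hj' : ((j - 1 : ℕ) : ℤ) = (j : ℤ) - 1 := by push_cast [Nat.cast_sub hj]; ring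
  have hc : (e : ℤ) * ((bWin p e : ℤ) + 2) + (aWin p e : ℤ) < ((j : ℤ) - 1) * (m : ℤ) + 2 := by
    rw [← hj']; exact_mod_cast hcon'
  have hm0 : (0 : ℤ) ≤ (m : ℤ) := by positivity
  have hA0 : (0 : ℤ) ≤ (aWin p e : ℤ) := by positivity
  have hB0 : (0 : ℤ) ≤ (bWin p e : ℤ) := by positivity
  have hj0 : (1 : ℤ) ≤ (j : ℤ) := by exact_mod_cast hj
  -- `D := j·m + 2 − e(B+2) − A ≥ m + 1`
  set Dd : ℤ := ((j : ℤ) + 1 - 1) * (m : ℤ) + 2 - (e : ℤ) * ((bWin p e : ℤ) + 2) - (aWin p e : ℤ) with hDd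
  have hD1 : (m : ℤ) + 1 ≤ Dd := by rw [hDd]; nlinarith
  have hprod : ((j : ℤ) + 1 + 1) * ((m : ℤ) + 1) ≤ ((j : ℤ) + 1 + 1) * Dd := mul_le_mul_of_nonneg_left hD1 (by linarith)
  have h2e : 2 * (e : ℤ) ≤ (e : ℤ) * ((bWin p e : ℤ) + 2) + (aWin p e : ℤ) := by nlinarith
  nlinarith

end IntegerSlice

/-! ## §2. The [LIN] cell is an initial segment of labels; closed index and bracket -/

section LinSlice

/-- **THE [LIN] CELL IS ANTITONE IN THE LABEL**: `(j₂²−1)·m ≤ (j₂+1)·S + e → j₁ ≤ j₂ → (j₁²−1)·m ≤ (j₁+1)·S + e` with `S = e·(B+1) + A − 2`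
(after dividing by `j+1`: `(j−1)·m` is nondecreasing and `S + e/(j+1)` nonincreasing in `j`). [folklore] -/
theorem intLin_anti {p e m j₁ j₂ : ℕ} (hj : j₁ ≤ j₂)
    (h : (((j₂ : ℤ)) ^ 2 - 1) * (m : ℤ) ≤ ((j₂ : ℤ) + 1) * ((e : ℤ) * ((bWin p e : ℤ) + 1) + (aWin p e : ℤ) - 2) + (e : ℤ)) :
    (((j₁ : ℤ)) ^ 2 - 1) * (m : ℤ) ≤ ((j₁ : ℤ) + 1) * ((e : ℤ) * ((bWin p e : ℤ) + 1) + (aWin p e : ℤ) - 2) + (e : ℤ) := by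
  set C : ℤ := (e : ℤ) * ((bWin p e : ℤ) + 1) + (aWin p e : ℤ) - 2 with hC
  have hj' : (j₁ : ℤ) ≤ (j₂ : ℤ) := by exact_mod_cast hj
  have hj0 : (0 : ℤ) ≤ (j₁ : ℤ) := by positivity
  have hm0 : (0 : ℤ) ≤ (m : ℤ) := by positivity
  have he0 : (0 : ℤ) ≤ (e : ℤ) := by positivity
  have hpos : (0 : ℤ) < (j₂ : ℤ) + 1 := by linarith
  have key : ((j₂ : ℤ) + 1) * ((((j₁ : ℤ)) ^ 2 - 1) * (m : ℤ)) ≤ ((j₂ : ℤ) + 1) * (((j₁ : ℤ) + 1) * C + (e : ℤ)) := by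
    have h1 : ((j₂ : ℤ) + 1) * ((((j₁ : ℤ)) ^ 2 - 1) * (m : ℤ)) =
        ((j₁ : ℤ) + 1) * (((j₁ : ℤ) - 1) * (((j₂ : ℤ) + 1) * (m : ℤ))) := by ring
    have hnn : (0 : ℤ) ≤ ((j₂ : ℤ) + 1) * (m : ℤ) := mul_nonneg hpos.le hm0
    have h2 : ((j₁ : ℤ) - 1) * (((j₂ : ℤ) + 1) * (m : ℤ)) ≤ ((j₂ : ℤ) - 1) * (((j₂ : ℤ) + 1) * (m : ℤ)) :=
      mul_le_mul_of_nonneg_right (by linarith) hnn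
    have h3 : ((j₁ : ℤ) + 1) * (((j₁ : ℤ) - 1) * (((j₂ : ℤ) + 1) * (m : ℤ))) ≤
        ((j₁ : ℤ) + 1) * (((j₂ : ℤ) - 1) * (((j₂ : ℤ) + 1) * (m : ℤ))) := mul_le_mul_of_nonneg_left h2 (by linarith)
    have h4 : ((j₂ : ℤ) - 1) * (((j₂ : ℤ) + 1) * (m : ℤ)) = (((j₂ : ℤ)) ^ 2 - 1) * (m : ℤ) := by ring
    have h5 : ((j₁ : ℤ) + 1) * ((((j₂ : ℤ)) ^ 2 - 1) * (m : ℤ)) ≤ ((j₁ : ℤ) + 1) * (((j₂ : ℤ) + 1) * C + (e : ℤ)) :=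
      mul_le_mul_of_nonneg_left h (by linarith)
    have h6 : ((j₁ : ℤ) + 1) * (e : ℤ) ≤ ((j₂ : ℤ) + 1) * (e : ℤ) := mul_le_mul_of_nonneg_right (by linarith) he0
    calc ((j₂ : ℤ) + 1) * ((((j₁ : ℤ)) ^ 2 - 1) * (m : ℤ))
        = ((j₁ : ℤ) + 1) * (((j₁ : ℤ) - 1) * (((j₂ : ℤ) + 1) * (m : ℤ))) := h1
      _ ≤ ((j₁ : ℤ) + 1) * (((j₂ : ℤ) - 1) * (((j₂ : ℤ) + 1) * (m : ℤ))) := h3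
      _ = ((j₁ : ℤ) + 1) * ((((j₂ : ℤ)) ^ 2 - 1) * (m : ℤ)) := by rw [h4]
      _ ≤ ((j₁ : ℤ) + 1) * (((j₂ : ℤ) + 1) * C + (e : ℤ)) := h5
      _ = ((j₂ : ℤ) + 1) * (((j₁ : ℤ) + 1) * C) + ((j₁ : ℤ) + 1) * (e : ℤ) := by ring
      _ ≤ ((j₂ : ℤ) + 1) * (((j₁ : ℤ) + 1) * C) + ((j₂ : ℤ) + 1) * (e : ℤ) := by linarith
      _ = ((j₂ : ℤ) + 1) * (((j₁ : ℤ) + 1) * C + (e : ℤ)) := by ring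
  exact le_of_mul_le_mul_left key hpos

/-- **THE [LIN] SLICE BOUNDARY EXISTS, NO SPORADIC LABELS**: `J` inside and `J+1` outside ⟹ ([LIN] at `j` ⟺ `j ≤ J`). [folklore] -/
theorem intLin_iff_le_of_boundary {p e m J : ℕ}
    (hJ : (((J : ℤ)) ^ 2 - 1) * (m : ℤ) ≤ ((J : ℤ) + 1) * ((e : ℤ) * ((bWin p e : ℤ) + 1) + (aWin p e : ℤ) - 2) + (e : ℤ))
    (hJ' : ¬ ((((J + 1 : ℕ) : ℤ)) ^ 2 - 1) * (m : ℤ) ≤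
      (((J + 1 : ℕ) : ℤ) + 1) * ((e : ℤ) * ((bWin p e : ℤ) + 1) + (aWin p e : ℤ) - 2) + (e : ℤ))
    (j : ℕ) :
    (((j : ℤ)) ^ 2 - 1) * (m : ℤ) ≤ ((j : ℤ) + 1) * ((e : ℤ) * ((bWin p e : ℤ) + 1) + (aWin p e : ℤ) - 2) + (e : ℤ) ↔ j ≤ J := by
  constructor
  · intro h
    by_contra hcon
    exact hJ' (intLin_anti (p := p) (by omega) h)
  · intro h
    exact intLin_anti (p := p) h hJ

/-- **THE [LIN] CLOSED INDEX**: `(j−1)·m ≤ S ⟹` [LIN] at `j` (`S = e(B+1) + A − 2`; since `(j²−1)·m = (j+1)·(j−1)·m ≤ (j+1)·S ≤ (j+1)·S + e`), so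
`j_c^LIN(w) = 1 + ⌊S/m_q⌋ ≤ j₀^LIN(w)`. [folklore] -/
theorem intLin_of_sub_one_mul_le {p e m j : ℕ}
    (h : ((j : ℤ) - 1) * (m : ℤ) ≤ (e : ℤ) * ((bWin p e : ℤ) + 1) + (aWin p e : ℤ) - 2) :
    (((j : ℤ)) ^ 2 - 1) * (m : ℤ) ≤ ((j : ℤ) + 1) * ((e : ℤ) * ((bWin p e : ℤ) + 1) + (aWin p e : ℤ) - 2) + (e : ℤ) := by
  set C : ℤ := (e : ℤ) * ((bWin p e : ℤ) + 1) + (aWin p e : ℤ) - 2 with hC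
  have hj0 : (0 : ℤ) ≤ (j : ℤ) := by positivity
  have he0 : (0 : ℤ) ≤ (e : ℤ) := by positivity
  have h1 : ((j : ℤ) + 1) * (((j : ℤ) - 1) * (m : ℤ)) ≤ ((j : ℤ) + 1) * C := mul_le_mul_of_nonneg_left h (by linarith)
  have h2 : (((j : ℤ)) ^ 2 - 1) * (m : ℤ) = ((j : ℤ) + 1) * (((j : ℤ) - 1) * (m : ℤ)) := by ring
  rw [h2]; linarith

/-- **THE [LIN] BRACKET `j₀^LIN ≤ j_c^LIN + 1`**: [LIN] at `j+1 ⟹ (j−1)·m ≤ S`. (If `(j−1)m ≥ S+1` then `j·m ≥ S+1+m`, and [LIN] at `j+1` reads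
`j(j+2)·m ≤ (j+2)·S + e`, so `(j+2)(m+1) ≤ e ≤ S + 2 ≤ (j−1)m + 1` — impossible.) [folklore] -/
theorem sub_one_mul_le_of_intLin_succ {p e m j : ℕ}
    (h : ((((j + 1 : ℕ) : ℤ)) ^ 2 - 1) * (m : ℤ) ≤
      (((j + 1 : ℕ) : ℤ) + 1) * ((e : ℤ) * ((bWin p e : ℤ) + 1) + (aWin p e : ℤ) - 2) + (e : ℤ)) :
    ((j : ℤ) - 1) * (m : ℤ) ≤ (e : ℤ) * ((bWin p e : ℤ) + 1) + (aWin p e : ℤ) - 2 := by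
  set C : ℤ := (e : ℤ) * ((bWin p e : ℤ) + 1) + (aWin p e : ℤ) - 2 with hC
  push_cast at h
  have hj0 : (0 : ℤ) ≤ (j : ℤ) := by positivity
  have hm0 : (0 : ℤ) ≤ (m : ℤ) := by positivity
  have he0 : (0 : ℤ) ≤ (e : ℤ) := by positivity
  have hA0 : (0 : ℤ) ≤ (aWin p e : ℤ) := by positivity
  have hB0 : (0 : ℤ) ≤ (bWin p e : ℤ) := by positivity
  have hCe : (e : ℤ) - 2 ≤ C := by rw [hC]; nlinarith
  by_contra hcon
  have hc : C + 1 ≤ ((j : ℤ) - 1) * (m : ℤ) := by linarith [not_le.1 hcon]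
  -- `(j+2)·(j·m) ≥ (j+2)·(C + 1 + m)` and `(j+1)²−1 = j(j+2)`
  have h1 : ((j : ℤ) + 1 + 1) * (C + 1 + (m : ℤ)) ≤ ((j : ℤ) + 1 + 1) * ((j : ℤ) * (m : ℤ)) :=
    mul_le_mul_of_nonneg_left (by linarith) (by linarith)
  have h2 : (((j : ℤ) + 1) ^ 2 - 1) * (m : ℤ) = ((j : ℤ) + 1 + 1) * ((j : ℤ) * (m : ℤ)) := by ring
  rw [h2] at h
  -- hence `(j+2)(1+m) ≤ e`, contradiction with `e ≤ C + 2 ≤ (j−1)m + 1`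
  nlinarith

end LinSlice

/-! ## §3. At the genuine datum: Σ₃ ∩ (place) is an initial segment of labels -/

section Genuine

variable {F K Fbar : Type} [Field F] [NumberField F] [Field K] [NumberField K] [Algebra F K] [Field Fbar]
  [Algebra F Fbar] [Algebra K Fbar] {E : WeierstrassCurve F} [E.IsElliptic] {l : ℕ} {Pb : BadPlacePredicates K}
  (D : InitialThetaData F K Fbar E l Pb) {logv : PadicLogs K} (hlog : LogvAnalytic logv)

/-- **H⋆₃'s [ED] CELL HOLDS ON AN INITIAL SEGMENT OF LABELS at a place of the genuine datum** (`p` odd, `p ∤ e(w|p) = e`, `P_q(w) = m`): if the cell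
holds at the label `i₂` then it holds at every `i₁ ≤ i₂` — SLICE.md row 3 (b): Σ₃ ∩ (place `w`) = `{1, …, j₀(w)}`.
[cite: Mochizuki2012, IUTchIV Prop. 1.2 (i)(ii) p. 10] [claim: Mochizuki2012, status: disputed] -/
theorem cellAt_pilotDataOfK_anti (pp : Nat.Primes) (i₁ i₂ : Fin (thetaIndex (pilotDataOfK D K)).lstar)
    (w : (thetaIndex (pilotDataOfK D K)).Fibre (.inr pp)) {e m : ℕ} (hp : 2 < (pp : ℕ))
    (hram : haveI : Fact (pp : ℕ).Prime := ⟨pp.2⟩; (placeOf (pilotDataOfK D K) pp.1 w).asIdeal.ramificationIdx ℤ = e)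
    (htame : ¬ (pp : ℕ) ∣ e)
    (hP : haveI : Fact (pp : ℕ).Prime := ⟨pp.2⟩; (pilotDataOfK D K).qPilot (placeOf (pilotDataOfK D K) pp.1 w) = m)
    (hi : (i₁ : ℕ) ≤ (i₂ : ℕ))
    (h : haveI : Fact (pp : ℕ).Prime := ⟨pp.2⟩; CellAt (pilotDataOfK D K) hlog pp i₂ w) :
    haveI : Fact (pp : ℕ).Prime := ⟨pp.2⟩
    CellAt (pilotDataOfK D K) hlog pp i₁ w := by
  have he1 : 1 ≤ e := by
    rcases Nat.eq_zero_or_pos e with h0 | h0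
    · exact absurd (h0 ▸ dvd_zero (pp : ℕ)) htame
    · exact h0
  have h2 := (cellAt_pilotDataOfK_iff_intCell D hlog pp i₂ w hp hram htame hP).1 h
  exact (cellAt_pilotDataOfK_iff_intCell D hlog pp i₁ w hp hram htame hP).2 (intCell_anti he1 (by omega) h2)

/-- **H⋆₃'s [LIN] CELL HOLDS ON AN INITIAL SEGMENT OF LABELS at a place of the genuine datum** (`p` odd, `p ∤ e(w|p) = e`, `P_q(w) = m`).
[cite: Mochizuki2012, IUTchIV Prop. 1.2 (i)(ii) p. 10] [claim: Mochizuki2012, status: disputed] -/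
theorem cellLinAt_pilotDataOfK_anti (pp : Nat.Primes) (i₁ i₂ : Fin (thetaIndex (pilotDataOfK D K)).lstar)
    (w : (thetaIndex (pilotDataOfK D K)).Fibre (.inr pp)) {e m : ℕ} (hp : 2 < (pp : ℕ))
    (hram : haveI : Fact (pp : ℕ).Prime := ⟨pp.2⟩; (placeOf (pilotDataOfK D K) pp.1 w).asIdeal.ramificationIdx ℤ = e)
    (htame : ¬ (pp : ℕ) ∣ e)
    (hP : haveI : Fact (pp : ℕ).Prime := ⟨pp.2⟩; (pilotDataOfK D K).qPilot (placeOf (pilotDataOfK D K) pp.1 w) = m)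
    (hi : (i₁ : ℕ) ≤ (i₂ : ℕ)) (h : CellLinAt (pilotDataOfK D K) pp i₂ w) :
    CellLinAt (pilotDataOfK D K) pp i₁ w := by
  have h2 := (cellLinAt_pilotDataOfK_iff_intLin D pp i₂ w hp hram htame hP).1 h
  exact (cellLinAt_pilotDataOfK_iff_intLin D pp i₁ w hp hram htame hP).2 (intLin_anti (p := pp) (by omega) h2)

end Genuine

/-! ## §4. One kernel evaluation: the boundary-layer label INSIDE the label range (G-HEX-k12-l71-ev3) -/

section Rows

/-- I06STAR-COLUMNS v1 G-HEX-k12-l71-ev3 (`p = 7`, `e = 3·71 = 213`, `m = 3·12 = 36`, `l⋆ = 35`, `B = 2`, `A = 43`): the closed index is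
`j_c = 1 + ⌊893/36⌋ = 25` (`ClosedSuff` fails at `26`), yet `IntCell` HOLDS at `26` (layer test `(j+1)·D + r = 27·7 + 9 = 198 < 213`) and FAILS at
`27`: here `j₀ = j_c + 1 = 26 < l⋆` — the bracket's upper end is attained inside the label range. [folklore] -/
theorem slice_k12_l71_ev3 : ¬ ClosedSuff 7 213 36 26 ∧ IntCell 7 213 36 26 ∧ ¬ IntCell 7 213 36 27 := by
  refine ⟨?_, ?_, ?_⟩
  · unfold ClosedSuff aWin bWin; decide
  · unfold IntCell aWin bWin; decide
  · unfold IntCell aWin bWin; decide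

end Rows

end Summit.ABC.IUTFork.Repair.RHHullCapacityNecessarySlice

end
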